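import Summits.QuantumFields.YangMills.Theorems.BalabanUVNodesK2CornerDriftOfU3
import Summits.QuantumFields.YangMills.Theorems.BalabanUVNodesK1V7RDefs
import Summits.QuantumFields.YangMills.Theorems.BalabanUVNodesK1R8OfCeilingKeyedRung1

/-!
# Route `BalabanUVNodes` rev 27 — THE CORNER ROAD IN THE ROWS CURRENCY (hypothesis form; 0 `def`, 0 `sorry`): K3⁷'s U3 letters (N17 `ScaleShiftRate` + the history moduli
# `HistLipschitz`) and a per-scale ANCHOR of the β of record, with a drift of the anchoring numbers, SUPPLY DEF-1's rows `RunRowsCont13 F θ` — rows (i), (iv) AND (C) — with NO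
# (190)-chain stub (1ᶜᴿ); hence the ∀θ programme `RowsContAll`, the K1 v7ᴿ stub-3 text `RunRowsContAtSomeRecord13PWS`, and K1⁸ `StabilityBRunRowsAtRecordR13SepCoPH` BY NAME

EDITION v1.1 (append-only: §4 added; §1–§3 byte-identical to v1.0 p620216).  Cell `ym-nodeO-ideate`, PROVER seat `ym-nodeO-port-1` (gen 3; director-ym №206 (3) ∕ R393 (a) «port the v₀-free corner road to `Theorems/` in hypothesis form»).  Fifth file of the corner road after
`…K2CornerRoad` (p599976), `…K2NamedJetsLimit` (p607079, seat d1-w1), `…K2CornerRoadSign` (p609637) and `…K2CornerDriftOfU3` (p613914).  Helper keyed `--supports stmt-QuantumFields-26907 --as helper`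
(K1⁸ `StabilityBRunRowsAtRecordR13SepCoPH`, crux r3 DECIDING since rev 27 `12afebc05bbc`; plan g84 REV26R-LANDED: corner suppliers key 26907; K2⁷ stmt-QuantumFields-20543 `aside`, its v7c skeleton
795c9e8285fed415 kept as a supplier road); count-neutral; NO skeleton is registered or re-keyed by this file.
WHY.  DEF-1's `…K1R8RowsDefs.RowsContAll` (p616926 :83) lists the K2 supplier roads of the rev-26ᴿ rows — «v6 named jets, v7-corner pair, U3 letters, an4's weak currency».  The corner PAIR
(2ᶜᴰ + 1ᶜᴿ) and the weak currency are b2b-an4's `…K2RunRowsContOfCorner` (p616839); the named-jets run letter `RunRemAt` is dag-n24-w1's `…K1V7RDefs` §3–§4 (p617892).  THIS FILE is the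
«U3 letters» road: on K3⁷'s letters the per-scale anchor ALONE manufactures the run-wise constant remainder at EVERY height (p599976 `constRemainder_of_scaleShiftRate_scaleAnchor`), the drift pays
the partial-sum floor (DEF-1 `runwisePS_of_drift_runConstRemainder`, p596574), and the history moduli pay run-wise survivor continuity (C) ([Balaban1987RG1] §1 pp. 263–264's continuity is, on
this road, the `HistLipschitz` letter: `T4BetaStationary.betaContH_of_histLipschitz` + DEF-1 `SurvCont.of_betaContH`) — so v7c's registered 1ᶜᴿ `RunChain190AtCornerDriftSlope` is NOT read,
and K1 v7ᴿ's third stub `stub_cont13` has, at a U3 witness, no separate (C) supplier to find.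
ATTRIBUTION.  idea-7's corner mathematics (p599976 §1, this seat g0) · DEF-1's letters and consumers (p593586 ∕ p596574 ∕ p616926) · dag-n17-w1's `survCont_anti` (p602302-lineage
`…N17RunRemAtOfShiftAnchorLevel`) · dag-n24-w1's v7ᴿ mirror and witness adapters (p617892) · plan g84's v7c 2ᶜᴰ text.  Nothing of theirs is restated; everything is used BY NAME.

CONTENTS.
§1 per tuple `(F, θ, hP)`, `D := Node00.datumOfRecord₁₃SepCoPH F 2 θ hP` (`D.βfun = Node00.betaOfRecord₁₃ F 2 θ.toStage13Params`, `rfl`):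
  ★ `runRowsCont13_of_letters_scaleAnchor_drift` (N17 + moduli + `ScaleAnchor D.βfun b` + `OneLoopDrift s A b`, `0 < s` ⟹ `RunRowsCont13 F θ`; (C) by the moduli) ·
  `runRowsCont13_of_scaleShiftRate_scaleAnchor_drift_survCont` (moduli-free: N17 + anchor + drift + `SurvCont` at ANY positive level) ·
  `runRowsCont13_of_letters_anchorJets_drift` (2ᴮ″ currency: the anchor at the θ-covariantly NAMED numbers `θ.cβ • beta0OfJs F κ` and the BARE drift at slope `stepBal 2 F.L`).
§2 K-keyed (texts INLINE at the crux keying `(unity ∧ slots) → Admissible → (B) → K2V6Defs.Window13 F θ hP`, U3ᴷ and the 2ᶜᴰ-text VERBATIM as in p613914):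
  `cont13All_of_histModuliK` (the MODULI HALF of the U3 letter at every admissible tuple with provisos ⟹ DEF-1's `Cont13All`) · `stub_cont13Text_of_histModuliK` (… hence K1 v7ᴿ's
  registered stub-3 TEXT, via p617892 `stub_cont13_of_cont13All`) · ★★ `rowsContAll_of_u3K_cornerDriftPosK` (U3ᴷ + v7c's REGISTERED 2ᶜᴰ text ⟹ `RowsContAll`) ·
  ★ `stabilityBRunRowsAtRecordR13SepCoPH_of_k17_u3K_cornerDriftPosK` (aside K1⁷ + U3ᴷ + 2ᶜᴰ ⟹ K1⁸ BY NAME).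
§3 at a K1 witness (rung-1 data `(θ, h, w)`: unity ∧ slots, admissibility, `K1V6Defs.RecordS F θ h w`, the thirteen nodes at every run):
  `runRowsContAtSomeRecord13PWS_of_rung1At_letters_anchorJets_drift_match` (U3 letters + named anchor + bare drift + the match `2(θ.cβ·stepBal 2 F.L) + 2|θ.cβ|A ≤ w.βup` ⟹ rung 2‴) ·
  ★★ `runRowsContAtSomeRecord13PWS_of_rung1At_letters_cornerDrift_lt` (κ-FREE, ANY SLACK: `ScaleAnchor b` + `OneLoopDrift s A b` + the OPEN match `s + 2A < w.βup` ⟹ rung 2‴ — the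
  every-height remainder makes the radius as small as the slack) · ★ `stabilityBRunRowsAtRecordR13SepCoPH_of_rung1WithCornerLetters` (K1⁸ BY NAME from ONE ∃-side corner producer).

§4 (EDITION v1.1, append-only; dag-n24-w1's ceiling-keyed rung-1 family `∀ c, ∃ w, c ≤ w.βup ∧ RecordS F θ h w ∧ ∀ P, Nodes (leavesP w P)` of p620073 VERBATIM): MATCH-FREE corner
  producers — `runRowsContAtSomeRecord13PWS_of_ceilingKeyedRung1_letters_cornerDrift` (κ-free: the world is requested at `s + 2A + 1`, then §3's any-slack producer; NO numeric letter) ·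
  `runRowsContAtSomeRecord13PWS_of_ceilingKeyedRung1_letters_anchorJets_drift` (2ᴮ″ currency, into p620073's `runRowsContAt_of_ceilingKeyedRung1_of_runRemAt_drift`) ·
  ★★ `stabilityBRunRowsAtRecordR13SepCoPH_of_ceilingKeyedRung1WithCornerLetters` (K1⁸ BY NAME: on the corner road with a ceiling-keyed world builder NODE O owes EXACTLY {anchor,
  positive drift} at the K1 witness — no match, no radius, no separate (C)).

HONEST FRAMING.  Implications between displayed HYPOTHESIS SHAPES and elementary real bookkeeping; NOTHING of Bałaban's analysis is asserted or discharged: N17, the history moduli, the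
anchor, the drift, the rung-1 data are hypotheses inhabited at no tuple here (instance 0∕1); no stub proved; K0⁷ stmt-QuantumFields-20541 ∕ K1⁸ stmt-QuantumFields-26907 ∕ K3⁷
stmt-QuantumFields-20544 OPEN; counts unmoved (typed 28∕28 · discharged 5∕27 (A 5∕28)); [Balaban1987RG1] Thm 2 + (0.31) p. 259 and §1's continuity are UNPROVED IN PRINT; route R4 closes
the CONDITIONAL finite-𝕋⁴ rung `BalabanLadder.UV` only — NOT the continuum limit, NOT ℝ⁴, NOT OS, NOT the Yang–Mills mass gap, NOT Clay.  No `def`, no `instance`, no `notation`, no `axiom`.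
Sources (context only; nothing printed is used as a hypothesis): [I] = [Balaban1987RG1] CMP **109** (1987): Thm 2 p. 259 (first sentence), (1.3) p. 260, §1 pp. 263–264, Thm 3 p. 264,
(1.20)–(1.22) p. 264, (2.12)–(2.14) p. 268, (5.10) p. 293; [II] = [Balaban1988RG2Cluster] CMP **116** (1988): Lemma 3 (2.38) p. 20, (2.41) p. 21; [V] = [Balaban1989LargeFieldII] CMP **122**
(1989): Thm 1 p. 355.
-/

noncomputable section

open scoped Matrix.Norms.L2Operator

namespace Summit.QuantumFields.YangMills.Theorems.BalabanUVNodesK2CornerRoadRows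

open Literature.MathematicalPhysics.QuantumFieldTheory.Balaban1983to89
open Literature.MathematicalPhysics.QuantumFieldTheory.Balaban1983to89.FlowStep
open Literature.MathematicalPhysics.QuantumFieldTheory.Balaban1983to89.FlowStepRuns
open Literature.MathematicalPhysics.QuantumFieldTheory.Balaban1983to89.DagBinding
open Literature.MathematicalPhysics.QuantumFieldTheory.Balaban1983to89.T4Continuum (T4Family)
open Literature.MathematicalPhysics.QuantumFieldTheory.Balaban1983to89.T4CouplingMatching (ScaleShiftRate HistLipschitz)
open Literature.MathematicalPhysics.QuantumFieldTheory.Balaban1983to89.Beta.Drift (OneLoopDrift)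
open Summit.QuantumFields.YangMills.Theorems.BalabanUVNodesK2JsOfRecord (StepColourData beta0OfJs)
open Summit.QuantumFields.YangMills.Theorems.BalabanUVNodesK2NamedJetsRemAt (ScaleAnchor ConstRemainder band_of_drift)
open Summit.QuantumFields.YangMills.Theorems.BalabanUVNodesK2NamedJetsRunRemAt
  (RunConstRemainder SurvCont runwisePS_of_drift_runConstRemainder runConstRemainder_of_constRemainder)
open Summit.QuantumFields.YangMills.Theorems.EndpointGivenBR13SepCoPH.Negative.RemNamedJets13FalseOfTwoNormalisations (oneLoopDrift_const_mul)
open Summit.QuantumFields.YangMills.Theorems.BalabanUVNodesK2V6Defs (Window13)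
open Summit.QuantumFields.YangMills.Theorems.BalabanUVNodesK2CornerRoad (constRemainder_of_scaleShiftRate_scaleAnchor runRemAt_of_letters_scaleAnchor)
open Summit.QuantumFields.YangMills.BalabanUVNodes.N17RunRemAtOfShiftAnchorLevel (survCont_anti)
open Summit.QuantumFields.YangMills.Theorems.K1V6Defs (RecordS Inhabited13 RunRowsAtSomeRecord13PWS)
open Summit.QuantumFields.YangMills.Theorems.BalabanUVNodesK1R8RowsDefs
  (RunRowsCont13 Cont13All RowsContAll runRowsCont13_intro runRowsCont13_of_rows_survCont_le stabilityBRunRowsAtRecordR13SepCoPH_of_k17_rowsContAll)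
open Summit.QuantumFields.YangMills.Theorems.K1V7RDefs
  (RunRowsContAtSomeRecord13PWS stub_cont13_of_cont13All runRowsContAtSomeRecord13PWS_of_runRemAt_drift_match stabilityBRunRowsAtRecordR13SepCoPH_of_rung0_runRowsCont)
open Summit.QuantumFields.YangMills.Theses.BalabanUVNodes (StabilityBAtRecordR13SepCoPH StabilityBRunRowsAtRecordR13SepCoPH)
open Summit.QuantumFields.YangMills.Theorems.K1R8OfCeilingKeyedRung1 (runRowsContAt_of_ceilingKeyedRung1_of_runRemAt_drift)

/-! ## §1 Per tuple: the U3 letters + a per-scale anchor + a drift SUPPLY DEF-1's rows `RunRowsCont13 F θ` — rows (i), (iv) and (C) -/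

section AtTuple

variable (F : T4Family) (θ : Node00.Stage13HParams F 2) (hP : θ.Provisos₁₃SepCoPH F 2)

/-- **★ THE CORNER ROAD IN THE ROWS CURRENCY, per tuple** (κ-free, v7c's corner currency): N17 `ScaleShiftRate c ρ θ.γ D.βfun` (`0 ≤ ρ < 1`, `0 < θ.γ`), the history moduli
`HistLipschitz Λ θ.γ D.βfun`, a per-scale anchor `ScaleAnchor D.βfun b` and a drift `OneLoopDrift s A b` with `0 < s` ⟹ DEF-1's rows `RunRowsCont13 F θ` — the constant remainder at the
height `s` itself on some level `0 < γ_s ≤ θ.γ` (p599976 `constRemainder_of_scaleShiftRate_scaleAnchor`) restricted to the in-window runs, the floor `−2A` from the drift with the cap met by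
`le_rfl`, and (C) on the survivor sets of level `γ_s` FROM THE MODULI (box continuity `betaContH_of_histLipschitz`, DEF-1's `SurvCont.of_betaContH`).  No (190)-chain letter is read.
CONDITIONAL on four hypothesis shapes; instance 0∕1; nothing of Bałaban asserted. [cite: Balaban1987RG1, Thm 3 p.264, (1.20)-(1.22) p.264, (2.12)-(2.14) p.268, (5.10) p.293 and §1 pp.263-264] -/
theorem runRowsCont13_of_letters_scaleAnchor_drift (hγ : 0 < θ.γ) {c ρ : ℝ} {Λ : ℕ → ℕ → ℝ} (hρ0 : 0 ≤ ρ) (hρ1 : ρ < 1)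
    (hss : ScaleShiftRate c ρ θ.γ (Node00.datumOfRecord₁₃SepCoPH F 2 θ hP).βfun) (hL : HistLipschitz Λ θ.γ (Node00.datumOfRecord₁₃SepCoPH F 2 θ hP).βfun)
    {b : ℕ → ℝ} {s A : ℝ} (hb : ScaleAnchor (Node00.datumOfRecord₁₃SepCoPH F 2 θ hP).βfun b) (hs : 0 < s) (hdrift : OneLoopDrift s A b) : RunRowsCont13 F θ := by
  obtain ⟨γs, hγs, hle, hrem⟩ := constRemainder_of_scaleShiftRate_scaleAnchor hγ hρ0 hρ1 hb hss hs
  have hrun := runConstRemainder_of_constRemainder hrem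
  exact runRowsCont13_intro θ hγs hrun (runwisePS_of_drift_runConstRemainder hdrift hrun le_rfl)
    (SurvCont.of_betaContH hγs fun k => (T4BetaStationary.betaContH_of_histLipschitz hL k).mono (box_mono hle k))

/-- **MODULI-FREE VARIANT: N17 + anchor + drift + run-wise (C) at ANY positive level** ⟹ `RunRowsCont13 F θ` — rows on the remainder's level `γ_s`, (C) brought at its own level `γc`, both
cut to `min γ_s γc` (DEF-1's `runRowsCont13_of_rows_survCont_le`; dag-n17-w1's `survCont_anti`: (C) is ANTITONE in the level).  For (C) suppliers that do not go through the moduli.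
CONDITIONAL; instance 0∕1. [cite: Balaban1987RG1, Thm 3 p.264, (1.20)-(1.22) p.264, (2.12)-(2.14) p.268 and §1 pp.263-264] -/
theorem runRowsCont13_of_scaleShiftRate_scaleAnchor_drift_survCont (hγ : 0 < θ.γ) {c ρ : ℝ} (hρ0 : 0 ≤ ρ) (hρ1 : ρ < 1)
    (hss : ScaleShiftRate c ρ θ.γ (Node00.datumOfRecord₁₃SepCoPH F 2 θ hP).βfun)
    {b : ℕ → ℝ} {s A : ℝ} (hb : ScaleAnchor (Node00.datumOfRecord₁₃SepCoPH F 2 θ hP).βfun b) (hs : 0 < s) (hdrift : OneLoopDrift s A b)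
    {γc : ℝ} (hγc : 0 < γc) (hsc : SurvCont (Node00.datumOfRecord₁₃SepCoPH F 2 θ hP).βfun γc) : RunRowsCont13 F θ := by
  obtain ⟨γs, hγs, -, hrem⟩ := constRemainder_of_scaleShiftRate_scaleAnchor hγ hρ0 hρ1 hb hss hs
  have hrun := runConstRemainder_of_constRemainder hrem
  exact runRowsCont13_of_rows_survCont_le θ (lt_min hγs hγc) (min_le_left _ _) hrun (runwisePS_of_drift_runConstRemainder hdrift hrun le_rfl)
    (survCont_anti (lt_min hγs hγc) (min_le_right _ _) hsc)

/-- **2ᴮ″ CURRENCY VARIANT (named jets): the U3 letters, the anchor at the θ-covariantly NAMED numbers `θ.cβ • beta0OfJs F κ` and the BARE drift of `beta0OfJs F κ` at slope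
`stepBal 2 F.L`** ⟹ `RunRowsCont13 F θ` — p599976 `runRemAt_of_letters_scaleAnchor` manufactures DEF-1's run letter `RunRemAt F κ θ hP θ.cβ` (remainder with cap `s ≤ θ.cβ·stepBal 2 F.L`,
(C) on its own level), the drift is rescaled by `oneLoopDrift_const_mul`, the floor is `−2|θ.cβ|A`.  CONDITIONAL; instance 0∕1.
[cite: Balaban1987RG1, Thm 3 p.264, (1.20)-(1.22) p.264, (2.12)-(2.14) p.268 and (5.10) p.293] -/
theorem runRowsCont13_of_letters_anchorJets_drift (κ : StepColourData) (hθ : θ.Admissible F 2) {c ρ : ℝ} {Λ : ℕ → ℕ → ℝ} (hρ0 : 0 ≤ ρ) (hρ1 : ρ < 1)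
    (hss : ScaleShiftRate c ρ θ.γ (Node00.datumOfRecord₁₃SepCoPH F 2 θ hP).βfun) (hL : HistLipschitz Λ θ.γ (Node00.datumOfRecord₁₃SepCoPH F 2 θ hP).βfun)
    (hA : ScaleAnchor (Node00.datumOfRecord₁₃SepCoPH F 2 θ hP).βfun (fun k => θ.cβ * beta0OfJs F κ k))
    {A : ℝ} (hdrift : OneLoopDrift (B12Normalization.stepBal 2 F.L) A (beta0OfJs F κ)) : RunRowsCont13 F θ := by
  obtain ⟨γ₀, s, hγ₀, -, hcap, hrem, -, hsc⟩ := runRemAt_of_letters_scaleAnchor F κ θ hP hθ hρ0 hρ1 hss hL hA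
  exact runRowsCont13_intro θ hγ₀ hrem (runwisePS_of_drift_runConstRemainder (oneLoopDrift_const_mul hdrift θ.cβ) hrem hcap) hsc

end AtTuple

/-! ## §2 K-keyed: the moduli pay the (C) letter; U3ᴷ + v7c's registered 2ᶜᴰ text pay the ∀θ rows programme, hence (with the aside K1⁷) K1⁸ BY NAME -/

section Texts

/-- **THE MODULI HALF OF K3⁷'s U3 LETTER PAYS THE (C) LETTER**: history moduli `HistLipschitz Λ θ.γ D.βfun` at EVERY admissible Stage-13 tuple with provisos ⟹ DEF-1's `Cont13All`
(run-wise survivor continuity of the β of record at every level `0 < γ₀ ≤ θ.γ`) — box continuity from the moduli, restricted to the level, then DEF-1's `SurvCont.of_betaContH`.  So on the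
corner road [Balaban1987RG1] §1's continuity sentence is OWED BY THE MODULI desks (in-box, `v₀`-free).  CONDITIONAL on the displayed letter; instance 0∕1.
[cite: Balaban1987RG1, §1 pp.263-264 and (2.13) p.268] -/
theorem cont13All_of_histModuliK
    (hMod : ∀ (F : T4Family) (θ : Node00.Stage13HParams F 2) (hP : θ.Provisos₁₃SepCoPH F 2), θ.Admissible F 2 →
      ∃ Λ : ℕ → ℕ → ℝ, HistLipschitz Λ θ.γ (Node00.datumOfRecord₁₃SepCoPH F 2 θ hP).βfun) : Cont13All := by
  intro F θ hP hθ γ₀ hγ₀ hle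
  obtain ⟨Λ, hL⟩ := hMod F θ hP hθ
  exact SurvCont.of_betaContH hγ₀ fun k => (T4BetaStationary.betaContH_of_histLipschitz hL k).mono (box_mono hle k)

/-- **… HENCE K1 v7ᴿ's REGISTERED STUB-3 TEXT** `∀ F, RunRowsAtSomeRecord13PWS F → RunRowsContAtSomeRecord13PWS F` (skeleton d90044cd05ffffb9 `stub_cont13`, mirrored by dag-n24-w1's
`K1V7RDefs`) from the moduli letter alone, through p617892's `stub_cont13_of_cont13All`.  CONDITIONAL on the letter; the stub is NOT closed by this theorem (its hypothesis is not supplied here).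
[cite: Balaban1987RG1, §1 pp.263-264, (2.13) p.268 and Thm 3 p.264] -/
theorem stub_cont13Text_of_histModuliK
    (hMod : ∀ (F : T4Family) (θ : Node00.Stage13HParams F 2) (hP : θ.Provisos₁₃SepCoPH F 2), θ.Admissible F 2 →
      ∃ Λ : ℕ → ℕ → ℝ, HistLipschitz Λ θ.γ (Node00.datumOfRecord₁₃SepCoPH F 2 θ hP).βfun) :
    ∀ F : T4Family, RunRowsAtSomeRecord13PWS F → RunRowsContAtSomeRecord13PWS F :=
  stub_cont13_of_cont13All (cont13All_of_histModuliK hMod)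

/-- **★★ U3ᴷ + v7c's REGISTERED JOINT STUB 2ᶜᴰ PAY THE ∀θ ROWS PROGRAMME `RowsContAll`** (texts VERBATIM as in p613914: U3ᴷ = K3⁷'s shared triple, 2ᶜᴰ-text = «some sequence anchoring
the β of record drifts with a POSITIVE slope»): per tuple §1's ★ — so on K3⁷'s letters the corner pair's SECOND registered stub 1ᶜᴿ `RunChain190AtCornerDriftSlope` is NOT needed for the
rev-26ᴿ rows (N17's every-height remainder replaces the (190)-chain's run rows, the moduli replace the (C) supplier).  With DEF-1's bridges this re-derives the aside K2⁷
(`endpointGivenBR13SepCoPH_of_rowsContAll`; cf. p613914's sign-road proof) and, with K1⁷, K1⁸ (next theorem).  CONDITIONAL on two hypothesis shapes; instance 0∕1; nothing of Bałaban asserted.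
[cite: Balaban1987RG1, Thm 3 p.264, (1.20)-(1.22) p.264, (2.12)-(2.14) p.268, (5.10) p.293 and §1 pp.263-264] -/
theorem rowsContAll_of_u3K_cornerDriftPosK
    (hU3 : ∀ (F : T4Family) (θ : Node00.Stage13HParams F 2) (hP : θ.Provisos₁₃SepCoPH F 2), (θ.ZhUnity F 2 ∧ θ.SlotsNondegenerate₁₃ F 2) → θ.Admissible F 2 →
      B16.EndStatementBPrinted (Node00.datumOfRecord₁₃SepCoPH F 2 θ hP).C → Window13 F θ hP →
      ∃ (c C ρ : ℝ) (Λ : ℕ → ℕ → ℝ), 0 ≤ c ∧ 0 < ρ ∧ ρ < 1 ∧ ScaleShiftRate c ρ θ.γ (Node00.datumOfRecord₁₃SepCoPH F 2 θ hP).βfun ∧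
        HistLipschitz Λ θ.γ (Node00.datumOfRecord₁₃SepCoPH F 2 θ hP).βfun ∧ T4CouplingMatching.FadingMemory C ρ Λ)
    (hCD : ∀ (F : T4Family) (θ : Node00.Stage13HParams F 2) (hP : θ.Provisos₁₃SepCoPH F 2), (θ.ZhUnity F 2 ∧ θ.SlotsNondegenerate₁₃ F 2) → θ.Admissible F 2 →
      B16.EndStatementBPrinted (Node00.datumOfRecord₁₃SepCoPH F 2 θ hP).C → Window13 F θ hP →
      ∃ (b : ℕ → ℝ) (s A : ℝ), ScaleAnchor (Node00.datumOfRecord₁₃SepCoPH F 2 θ hP).βfun b ∧ 0 < s ∧ OneLoopDrift s A b) : RowsContAll := by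
  intro F θ hP hU hθ hB hwin
  obtain ⟨c, -, ρ, Λ, -, hρ0, hρ1, hss, hL, -⟩ := hU3 F θ hP hU hθ hB hwin
  obtain ⟨b, s, A, hb, hs, hdrift⟩ := hCD F θ hP hU hθ hB hwin
  exact runRowsCont13_of_letters_scaleAnchor_drift F θ hP hθ.toStage12.toStage9.gamma_pos hρ0.le hρ1 hss hL hb hs hdrift

/-- **★ THE ASIDE K1⁷ + U3ᴷ + 2ᶜᴰ ⟹ THE DECIDING CRUX K1⁸ `…Theses.BalabanUVNodes.StabilityBRunRowsAtRecordR13SepCoPH` (stmt-QuantumFields-26907) BY NAME** — DEF-1's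
`stabilityBRunRowsAtRecordR13SepCoPH_of_k17_rowsContAll` fed by the theorem above: the rows are read at K1⁷'s own witness.  CONDITIONAL on three displayed texts (none supplied here);
K1⁸ NOT closed; nothing of Bałaban asserted; no count moved. [cite: Balaban1989LargeFieldII, Thm 1 p.355; Balaban1987RG1, Thm 3 p.264, (1.20)-(1.22) p.264, (5.10) p.293 and §1 pp.263-264] -/
theorem stabilityBRunRowsAtRecordR13SepCoPH_of_k17_u3K_cornerDriftPosK (h1 : StabilityBAtRecordR13SepCoPH)
    (hU3 : ∀ (F : T4Family) (θ : Node00.Stage13HParams F 2) (hP : θ.Provisos₁₃SepCoPH F 2), (θ.ZhUnity F 2 ∧ θ.SlotsNondegenerate₁₃ F 2) → θ.Admissible F 2 →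
      B16.EndStatementBPrinted (Node00.datumOfRecord₁₃SepCoPH F 2 θ hP).C → Window13 F θ hP →
      ∃ (c C ρ : ℝ) (Λ : ℕ → ℕ → ℝ), 0 ≤ c ∧ 0 < ρ ∧ ρ < 1 ∧ ScaleShiftRate c ρ θ.γ (Node00.datumOfRecord₁₃SepCoPH F 2 θ hP).βfun ∧
        HistLipschitz Λ θ.γ (Node00.datumOfRecord₁₃SepCoPH F 2 θ hP).βfun ∧ T4CouplingMatching.FadingMemory C ρ Λ)
    (hCD : ∀ (F : T4Family) (θ : Node00.Stage13HParams F 2) (hP : θ.Provisos₁₃SepCoPH F 2), (θ.ZhUnity F 2 ∧ θ.SlotsNondegenerate₁₃ F 2) → θ.Admissible F 2 →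
      B16.EndStatementBPrinted (Node00.datumOfRecord₁₃SepCoPH F 2 θ hP).C → Window13 F θ hP →
      ∃ (b : ℕ → ℝ) (s A : ℝ), ScaleAnchor (Node00.datumOfRecord₁₃SepCoPH F 2 θ hP).βfun b ∧ 0 < s ∧ OneLoopDrift s A b) :
    StabilityBRunRowsAtRecordR13SepCoPH :=
  stabilityBRunRowsAtRecordR13SepCoPH_of_k17_rowsContAll h1 (rowsContAll_of_u3K_cornerDriftPosK hU3 hCD)

end Texts

/-! ## §3 At a K1 witness: rung-1 data + the corner letters ⟹ K1 v7ᴿ's rung 2‴ `RunRowsContAtSomeRecord13PWS F`; K1⁸ BY NAME from ONE ∃-side corner producer -/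

section Witness

variable {F : T4Family}

/-- **2ᴮ″ CURRENCY AT THE WITNESS**: rung-1 data `(θ, h, w)` (unity ∧ slots, admissibility, an S-bound world of the datum `RecordS F θ h w`, the thirteen DAG nodes at every run) + the U3
letters + the named anchor `θ.cβ • beta0OfJs F κ` + the bare drift (defect `A`) + the numeric match `2(θ.cβ·stepBal 2 F.L) + 2|θ.cβ|A ≤ w.βup` ⟹ rung 2‴ — p599976's
`runRemAt_of_letters_scaleAnchor` then dag-n24-w1's `runRowsContAtSomeRecord13PWS_of_runRemAt_drift_match` (p617892) BY NAME.  CONDITIONAL; closes nothing.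
[cite: Balaban1987RG1, Thm 3 p.264, (1.20)-(1.22) p.264, (2.12)-(2.14) p.268, (5.10) p.293 and §1 pp.263-264] -/
theorem runRowsContAtSomeRecord13PWS_of_rung1At_letters_anchorJets_drift_match (θ : Node00.Stage13HParams F 2) (h : θ.Provisos₁₃SepCoPH F 2) (w : WorldP)
    (hU : θ.ZhUnity F 2 ∧ θ.SlotsNondegenerate₁₃ F 2) (hθ : θ.Admissible F 2) (hR : RecordS F θ h w) (hnodes : ∀ P : B12.RunParams, Nodes (leavesP w P))
    (κ : StepColourData) {c ρ : ℝ} {Λ : ℕ → ℕ → ℝ} (hρ0 : 0 ≤ ρ) (hρ1 : ρ < 1)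
    (hss : ScaleShiftRate c ρ θ.γ (Node00.datumOfRecord₁₃SepCoPH F 2 θ h).βfun) (hL : HistLipschitz Λ θ.γ (Node00.datumOfRecord₁₃SepCoPH F 2 θ h).βfun)
    (hA : ScaleAnchor (Node00.datumOfRecord₁₃SepCoPH F 2 θ h).βfun (fun k => θ.cβ * beta0OfJs F κ k))
    {A : ℝ} (hdrift : OneLoopDrift (B12Normalization.stepBal 2 F.L) A (beta0OfJs F κ))
    (hmatch : 2 * (θ.cβ * B12Normalization.stepBal 2 F.L) + 2 * (|θ.cβ| * A) ≤ w.βup) : RunRowsContAtSomeRecord13PWS F :=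
  runRowsContAtSomeRecord13PWS_of_runRemAt_drift_match θ h w hU hθ hR hnodes κ (runRemAt_of_letters_scaleAnchor F κ θ h hθ hρ0 hρ1 hss hL hA) hdrift hmatch

/-- **★★ κ-FREE, ANY SLACK: rung-1 data + the U3 letters + a per-scale anchor `ScaleAnchor D.βfun b` + a drift `OneLoopDrift s A b` (`0 < s`) + the OPEN match `s + 2A < w.βup`
⟹ rung 2‴** `RunRowsContAtSomeRecord13PWS F`.  The drift is a band `b_k ≤ s + 2A` (DEF-1 `band_of_drift`); on the corner road the remainder radius is AS SMALL AS WE PLEASE (every height,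
p599976), so it is taken `r := min s (w.βup − (s + 2A)) > 0`: the ceiling match `(s + 2A) + r ≤ w.βup` holds with ANY slack and the floor's cap `r ≤ s` by `min_le_left`; (C) from the
moduli on the remainder's level.  On this road the K1 ceiling owes the drift's BAND only — no `stepBal`∕cap term.  CONDITIONAL; closes nothing.
[cite: Balaban1987RG1, Thm 3 p.264, (1.20)-(1.22) p.264, (2.12)-(2.14) p.268, (5.10) p.293 and §1 pp.263-264; Balaban1988RG2Cluster, Lemma 3 (2.38) p.20] -/
theorem runRowsContAtSomeRecord13PWS_of_rung1At_letters_cornerDrift_lt (θ : Node00.Stage13HParams F 2) (h : θ.Provisos₁₃SepCoPH F 2) (w : WorldP)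
    (hU : θ.ZhUnity F 2 ∧ θ.SlotsNondegenerate₁₃ F 2) (hθ : θ.Admissible F 2) (hR : RecordS F θ h w) (hnodes : ∀ P : B12.RunParams, Nodes (leavesP w P))
    {c ρ : ℝ} {Λ : ℕ → ℕ → ℝ} (hρ0 : 0 ≤ ρ) (hρ1 : ρ < 1)
    (hss : ScaleShiftRate c ρ θ.γ (Node00.datumOfRecord₁₃SepCoPH F 2 θ h).βfun) (hL : HistLipschitz Λ θ.γ (Node00.datumOfRecord₁₃SepCoPH F 2 θ h).βfun)
    {b : ℕ → ℝ} {s A : ℝ} (hb : ScaleAnchor (Node00.datumOfRecord₁₃SepCoPH F 2 θ h).βfun b) (hs : 0 < s) (hdrift : OneLoopDrift s A b)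
    (hmatch : s + 2 * A < w.βup) : RunRowsContAtSomeRecord13PWS F := by
  have hγ : 0 < θ.γ := hθ.toStage12.toStage9.gamma_pos
  have hr : 0 < min s (w.βup - (s + 2 * A)) := lt_min hs (by linarith)
  obtain ⟨γr, hγr, hle, hrem⟩ := constRemainder_of_scaleShiftRate_scaleAnchor hγ hρ0 hρ1 hb hss hr
  have hrun := runConstRemainder_of_constRemainder hrem
  have hband : ∀ k, b k ≤ s + 2 * A := fun k => by
    have := (abs_le.mp (band_of_drift hdrift k)).2
    linarith
  have hmatch' : s + 2 * A + min s (w.βup - (s + 2 * A)) ≤ w.βup := by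
    have := min_le_right s (w.βup - (s + 2 * A))
    linarith
  exact ⟨θ, h, w, hU, hθ, hR, hnodes, b, _, γr, s + 2 * A, 2 * A, hγr, hrun, hband, hmatch',
    runwisePS_of_drift_runConstRemainder hdrift hrun (min_le_left _ _),
    SurvCont.of_betaContH hγr fun k => (T4BetaStationary.betaContH_of_histLipschitz hL k).mono (box_mono hle k)⟩

/-- **★ K1⁸ stmt-QuantumFields-26907 BY NAME FROM ONE ∃-SIDE CORNER PRODUCER**: for every family with a unity Stage-13 tuple (K0⁷'s conclusion, `K1V6Defs.Inhabited13 F`), SOME unity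
admissible tuple `θ` with provisos carries K3⁷'s U3 letters on its datum's β (N17 with `0 ≤ ρ < 1`, history moduli), a per-scale anchor `b` drifting with a POSITIVE slope `s` and defect `A`,
and an S-bound world `w` of its datum (`K1V6Defs.RecordS`) built above `s + 2A` all of whose runs' leaf worlds satisfy the thirteen DAG nodes ⟹ `…Theses.BalabanUVNodes.StabilityBRunRowsAtRecordR13SepCoPH`
(the TYPE is the route decl literally) — ★★ above, then dag-n24-w1's `stabilityBRunRowsAtRecordR13SepCoPH_of_rung0_runRowsCont` (p617892; (B) and the window by the run-letter END road of
record p598782 §2).  What NODE O owes K1⁸ on the corner road, AT THE K1 WITNESS ONLY: the anchor (identification) and the drift's sign; the U3 letters are K3⁷'s.  CONDITIONAL on `hprod` (not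
supplied here); K1⁸ NOT closed by this theorem; nothing of Bałaban asserted; no count moved.
[cite: Balaban1989LargeFieldII, Thm 1 p.355 and (0.1) pp.355-356; Balaban1987RG1, Thm 2 p.259 (first sentence), Thm 3 p.264, (1.20)-(1.22) p.264, (2.12)-(2.14) p.268, (5.10) p.293 and §1 pp.263-264] -/
theorem stabilityBRunRowsAtRecordR13SepCoPH_of_rung1WithCornerLetters
    (hprod : ∀ F : T4Family, Inhabited13 F →
      ∃ (θ : Node00.Stage13HParams F 2) (h : θ.Provisos₁₃SepCoPH F 2), (θ.ZhUnity F 2 ∧ θ.SlotsNondegenerate₁₃ F 2) ∧ θ.Admissible F 2 ∧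
        (∃ (c ρ : ℝ) (Λ : ℕ → ℕ → ℝ), 0 ≤ ρ ∧ ρ < 1 ∧ ScaleShiftRate c ρ θ.γ (Node00.datumOfRecord₁₃SepCoPH F 2 θ h).βfun ∧
          HistLipschitz Λ θ.γ (Node00.datumOfRecord₁₃SepCoPH F 2 θ h).βfun) ∧
        ∃ (b : ℕ → ℝ) (s A : ℝ), ScaleAnchor (Node00.datumOfRecord₁₃SepCoPH F 2 θ h).βfun b ∧ 0 < s ∧ OneLoopDrift s A b ∧
          ∃ w : WorldP, s + 2 * A < w.βup ∧ RecordS F θ h w ∧ ∀ P : B12.RunParams, Nodes (leavesP w P)) :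
    StabilityBRunRowsAtRecordR13SepCoPH :=
  stabilityBRunRowsAtRecordR13SepCoPH_of_rung0_runRowsCont fun F hinh => by
    obtain ⟨θ, hP, hU, hθ, ⟨c, ρ, Λ, hρ0, hρ1, hss, hL⟩, b, s, A, hb, hs, hdrift, w, hmatch, hR, hnodes⟩ := hprod F hinh
    exact runRowsContAtSomeRecord13PWS_of_rung1At_letters_cornerDrift_lt θ hP w hU hθ hR hnodes hρ0 hρ1 hss hL hb hs hdrift hmatch

end Witness

/-! ## §4 (EDITION v1.1) Ceiling-keyed rung 1: the MATCH-FREE corner producers and K1⁸ BY NAME with NO numeric letter -/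

section CeilingKeyed

variable {F : T4Family}

/-- **★ κ-FREE AND MATCH-FREE: ceiling-keyed rung-1 data at `(θ, h)`** (unity ∧ slots, admissibility, and for EVERY requested ceiling `c` an S-bound world `w` of the datum with `c ≤ w.βup`
and the thirteen nodes at every run — dag-n24-w1's family of p620073 VERBATIM, the rung-1 lanes' export «world built above the requested ceiling») + the U3 letters + a per-scale anchor
`ScaleAnchor D.βfun b` + a drift `OneLoopDrift s A b` (`0 < s`) ⟹ rung 2‴ `RunRowsContAtSomeRecord13PWS F`: request the world at `s + 2A + 1` and apply §3's any-slack producer.  No numeric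
letter remains.  CONDITIONAL; closes nothing. [cite: Balaban1988Convergent, Thm 1 p.262 and (2.6) p.255; Balaban1987RG1, Thm 3 p.264, (1.20)-(1.22) p.264, (2.12)-(2.14) p.268, (5.10) p.293 and §1 pp.263-264] -/
theorem runRowsContAtSomeRecord13PWS_of_ceilingKeyedRung1_letters_cornerDrift (θ : Node00.Stage13HParams F 2) (h : θ.Provisos₁₃SepCoPH F 2)
    (hU : θ.ZhUnity F 2 ∧ θ.SlotsNondegenerate₁₃ F 2) (hθ : θ.Admissible F 2)
    (hfam : ∀ c : ℝ, ∃ w : WorldP, c ≤ w.βup ∧ RecordS F θ h w ∧ ∀ P : B12.RunParams, Nodes (leavesP w P))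
    {c ρ : ℝ} {Λ : ℕ → ℕ → ℝ} (hρ0 : 0 ≤ ρ) (hρ1 : ρ < 1)
    (hss : ScaleShiftRate c ρ θ.γ (Node00.datumOfRecord₁₃SepCoPH F 2 θ h).βfun) (hL : HistLipschitz Λ θ.γ (Node00.datumOfRecord₁₃SepCoPH F 2 θ h).βfun)
    {b : ℕ → ℝ} {s A : ℝ} (hb : ScaleAnchor (Node00.datumOfRecord₁₃SepCoPH F 2 θ h).βfun b) (hs : 0 < s) (hdrift : OneLoopDrift s A b) :
    RunRowsContAtSomeRecord13PWS F := by
  obtain ⟨w, hc, hR, hnodes⟩ := hfam (s + 2 * A + 1)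
  exact runRowsContAtSomeRecord13PWS_of_rung1At_letters_cornerDrift_lt θ h w hU hθ hR hnodes hρ0 hρ1 hss hL hb hs hdrift (by linarith)

/-- **2ᴮ″ CURRENCY, MATCH-FREE**: ceiling-keyed rung-1 data + the U3 letters + the named anchor `θ.cβ • beta0OfJs F κ` + the bare drift ⟹ rung 2‴ — p599976's `runRemAt_of_letters_scaleAnchor`
fed into dag-n24-w1's `runRowsContAt_of_ceilingKeyedRung1_of_runRemAt_drift` (p620073).  CONDITIONAL; closes nothing.
[cite: Balaban1988Convergent, Thm 1 p.262; Balaban1987RG1, Thm 3 p.264, (1.20)-(1.22) p.264, (2.12)-(2.14) p.268 and (5.10) p.293] -/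
theorem runRowsContAtSomeRecord13PWS_of_ceilingKeyedRung1_letters_anchorJets_drift (θ : Node00.Stage13HParams F 2) (h : θ.Provisos₁₃SepCoPH F 2)
    (hU : θ.ZhUnity F 2 ∧ θ.SlotsNondegenerate₁₃ F 2) (hθ : θ.Admissible F 2)
    (hfam : ∀ c : ℝ, ∃ w : WorldP, c ≤ w.βup ∧ RecordS F θ h w ∧ ∀ P : B12.RunParams, Nodes (leavesP w P))
    (κ : StepColourData) {c ρ : ℝ} {Λ : ℕ → ℕ → ℝ} (hρ0 : 0 ≤ ρ) (hρ1 : ρ < 1)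
    (hss : ScaleShiftRate c ρ θ.γ (Node00.datumOfRecord₁₃SepCoPH F 2 θ h).βfun) (hL : HistLipschitz Λ θ.γ (Node00.datumOfRecord₁₃SepCoPH F 2 θ h).βfun)
    (hA : ScaleAnchor (Node00.datumOfRecord₁₃SepCoPH F 2 θ h).βfun (fun k => θ.cβ * beta0OfJs F κ k))
    {A : ℝ} (hdrift : OneLoopDrift (B12Normalization.stepBal 2 F.L) A (beta0OfJs F κ)) : RunRowsContAtSomeRecord13PWS F :=
  runRowsContAt_of_ceilingKeyedRung1_of_runRemAt_drift θ h hU hθ hfam κ (runRemAt_of_letters_scaleAnchor F κ θ h hθ hρ0 hρ1 hss hL hA) hdrift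

/-- **★★ K1⁸ stmt-QuantumFields-26907 BY NAME WITH NO NUMERIC LETTER**: for every family with a unity Stage-13 tuple, SOME unity admissible tuple `θ` with provisos carries a CEILING-KEYED
family of S-bound worlds of its datum with the thirteen nodes (the rung-1 lanes' export), K3⁷'s U3 letters on its datum's β, and a per-scale anchor drifting with a POSITIVE slope ⟹
`…Theses.BalabanUVNodes.StabilityBRunRowsAtRecordR13SepCoPH` (the TYPE is the route decl literally).  On the corner road with a ceiling-keyed world builder, NODE O owes K1⁸ AT THE K1
WITNESS exactly {the anchor (identification), the drift's positive slope}: no match, no radius, no separate (C) supplier, no (190)-chain stub.  CONDITIONAL on `hprod` (not supplied here);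
K1⁸ NOT closed by this theorem; nothing of Bałaban asserted; no count moved.
[cite: Balaban1989LargeFieldII, Thm 1 p.355 and (0.1) pp.355-356; Balaban1988Convergent, Thm 1 p.262 and (2.6) p.255; Balaban1987RG1, Thm 2 p.259 (first sentence), Thm 3 p.264, (1.20)-(1.22) p.264, (2.12)-(2.14) p.268, (5.10) p.293 and §1 pp.263-264] -/
theorem stabilityBRunRowsAtRecordR13SepCoPH_of_ceilingKeyedRung1WithCornerLetters
    (hprod : ∀ F : T4Family, Inhabited13 F →
      ∃ (θ : Node00.Stage13HParams F 2) (h : θ.Provisos₁₃SepCoPH F 2), (θ.ZhUnity F 2 ∧ θ.SlotsNondegenerate₁₃ F 2) ∧ θ.Admissible F 2 ∧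
        (∀ c : ℝ, ∃ w : WorldP, c ≤ w.βup ∧ RecordS F θ h w ∧ ∀ P : B12.RunParams, Nodes (leavesP w P)) ∧
        (∃ (c ρ : ℝ) (Λ : ℕ → ℕ → ℝ), 0 ≤ ρ ∧ ρ < 1 ∧ ScaleShiftRate c ρ θ.γ (Node00.datumOfRecord₁₃SepCoPH F 2 θ h).βfun ∧
          HistLipschitz Λ θ.γ (Node00.datumOfRecord₁₃SepCoPH F 2 θ h).βfun) ∧
        ∃ (b : ℕ → ℝ) (s A : ℝ), ScaleAnchor (Node00.datumOfRecord₁₃SepCoPH F 2 θ h).βfun b ∧ 0 < s ∧ OneLoopDrift s A b) :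
    StabilityBRunRowsAtRecordR13SepCoPH :=
  stabilityBRunRowsAtRecordR13SepCoPH_of_rung0_runRowsCont fun F hinh => by
    obtain ⟨θ, hP, hU, hθ, hfam, ⟨c, ρ, Λ, hρ0, hρ1, hss, hL⟩, b, s, A, hb, hs, hdrift⟩ := hprod F hinh
    exact runRowsContAtSomeRecord13PWS_of_ceilingKeyedRung1_letters_cornerDrift θ hP hU hθ hfam hρ0 hρ1 hss hL hb hs hdrift

end CeilingKeyed

end Summit.QuantumFields.YangMills.Theorems.BalabanUVNodesK2CornerRoadRows

end
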